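import Summits.MatrixMultiplication.MatrixMultiplication.Theorems.ObstructionDescentTopCoefficient
import Summits.MatrixMultiplication.MatrixMultiplication.Theorems.ObstructionDescentBlockRestriction
import Literature.Computability.AlgebraicComplexity.BI17FundamentalInvariantTensors

set_option linter.dupNamespace false

/-!
# Obstruction descent, part K — THE PAIR LAW (H19 of NODE-g15)

`route-MatrixMultiplication-ObstructionDescent`, aside `InvariantSaturation` (stmt 32282); decomp-mm lens-3, NODE-g15.

**`evalT_eq_zero_of_blockWindow`.**  A level-`k` vector `f` of the full format `m` (type `((k^m))³`, degree `km`)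
all of whose `2×2×2` BLOCK WINDOWS through a cell `(a,b,c)` are dead — `f(y) = 0` whenever `y` is supported on
`{a,a'}×{b,b'}×{c,c'} ∪ (the complementary corner)` — vanishes at every tensor of rank `≤ r` as soon as
`(k−1)(r−1) < k(m−1)`; for `k = 3` this is `2r + 1 < 3m`, i.e. `r_m(3) ≥ 3m/2` (`m` even), `≥ (3m−1)/2` (`m` odd):
the PAIR LAW H19 (`r₄(3) ≥ 6`, `r₆(3) ≥ 9` — exact with the census certificate `c₅₁ = 36/5` —, `r₈(3) ≥ 12`,
`r₉(3) ≥ 13`).  Its only non-formal input is the vacuity of the `(m−2,2)` window; **§5** derives the dead block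
windows (`blockWindow_dead_of_emptyLevel_two`) from the tower hypothesis `k ∈ emptyLevels m 2` («level `k` is EMPTY at
block format `2`», for `k = 3` the Kronecker vacuity `k₂(3) = g((3,3),(3,3),(3,3)) = 0`) by three slot relabellings
(Levi–Weyl law H12) and the Levi restriction law H13 (`ObstructionDescentBlockRestriction`), so that the law reads, in the
language of the invariant tower: `k ∈ emptyLevels m 2 → (k−1)(r−1) < k(m−1) → R(t) ≤ r → k ∉ E'_m(t)`
(`evalT_eq_zero_of_emptyLevel_two`, `not_mem_pointLevels_of_emptyLevel_two`, `…_level_three`).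

MECHANISM (a simplification of the bus derivation STATUS l.891, found while typing): with `t_j = h·e_{abc}`
(`h ∈ GL_m³`, full covariance of part H) the `λ_j^k`-coefficient of `Φ(λ) = f(Σ_i λ_i t_i)` is
`χ(h) · f^{(e)}(h⁻¹ Σ_{i≠j} λ_i t_i)`, where `f^{(e)}` is the top coefficient of part J; dead block windows kill the
monomials `x_e^k x_{e'}^k⋯` of `f` (part J §2) and the weights kill `x_e^k x_{e'}^{k}` for `e'` on a slice of `e`
(part I), so `f^{(e)}` has all exponents `≤ k − 1`, hence line degree `≤ k − 1` along every coordinate cell, hence —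
by transport along the stabiliser of `e_{abc}` (part J §3) — along every triad; part H (`evalT_sum_eq_zero_of_lineDegree`)
applied to `f^{(e)}` on the `r − 1` remaining summands gives `deg_{λ_j} Φ ≤ k − 1` for every `j`, and part H §1
(`eq_zero_of_isHomogeneous_of_degreeOf_le`) gives `Φ = 0` since `(k−1)·r < k·m`.

[cite: BurgisserIkenmeyer2011, §6.2] (Strassen's invariant of type `((3^m),(3^m),(m,m,m))` vanishing on `σ_r`,
`r ≤ ⌈3m/2⌉ − 1` — the conjugate-type sibling of the level-3 column, same range, commutator proof),
[cite: LandsbergGCT2017, §8.3.4] (prolongation), [cite: BurgisserIkenmeyer2013, Prop. 4.2].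
-/

open scoped BigOperators
open Finset

namespace Summit.MatrixMultiplication.MatrixMultiplication.Theorems.ObstructionCalculus

open Literature.Computability.AlgebraicComplexity (actTensor actTensor_apply actTensor_actTensor actTensor_one
  actTensor_zero actTensor_triad actTensor_permMatrix_apply triad triad_apply tensorRank exists_eq_sum_triad_of_tensorRank_le)

variable {m : ℕ}

/-! ### §4 The pair law -/

section PairLaw

/-- `r`-bookkeeping: `(k−1)(r−1) < k(m−1)` implies `(k−1)·r < k·m`. [bookkeeping] -/
theorem pairLaw_arith {k r m' : ℕ} (hr : (k - 1) * (r - 1) < k * (m' - 1)) : (k - 1) * r < k * m' := by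
  have hk : 0 < k := Nat.pos_of_ne_zero fun h => by rw [h, zero_mul] at hr; exact Nat.not_lt_zero _ hr
  have hm : 0 < m' := Nat.pos_of_ne_zero fun h => by
    subst h
    simp at hr
  have h2 : k * (m' - 1) + k = k * m' := by
    rw [Nat.mul_sub_one, Nat.sub_add_cancel (Nat.le_mul_of_pos_right k hm)]
  rcases Nat.eq_zero_or_pos r with hr0 | hr0
  · rw [hr0, mul_zero]
    exact Nat.mul_pos hk hm
  · have h1 : (k - 1) * r = (k - 1) * (r - 1) + (k - 1) := by
      conv_lhs => rw [← Nat.sub_add_cancel hr0, Nat.mul_succ]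
    have h3 : k - 1 < k := Nat.sub_lt hk one_pos
    omega

/-- **THE PAIR LAW (kernel form; H19 of NODE-g15).**  Let `f` be a level-`k` vector of the full format `m`
(type `((k^m))³`, degree `k·m`) and `(a,b,c)` a cell such that every `2×2×2` block window through it is dead:
for all `a' ≠ a`, `b' ≠ b`, `c' ≠ c`, `f(y) = 0` whenever `y` is supported on the block
`{a,a'}×{b,b'}×{c,c'}` together with its complementary corner (`x ∉ {a,a'}`, `y ∉ {b,b'}`, `z ∉ {c,c'}`).
Then `f` vanishes at every tensor of rank `≤ r` as soon as `(k−1)(r−1) < k(m−1)` — for level `3`: `2r + 1 < 3m`.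
(The dead-window input is the vacuity of the `(m−2,2)` window, `g((3,3),(3,3),(3,3)) = 0` at level `3`; it gives
`r₄(3) ≥ 6`, `r₆(3) ≥ 9`, `r₈(3) ≥ 12`, `r₉(3) ≥ 13`.) [this node] [cite: BurgisserIkenmeyer2011, §6.2] -/
theorem evalT_eq_zero_of_blockWindow {k : ℕ} {f : MvPolynomial (Idx m) ℂ}
    (hf : f ∈ hwvSpace (rectType m m k) (k * m)) {a b c : Fin m}
    (hblock : ∀ a' b' c' : Fin m, a' ≠ a → b' ≠ b → c' ≠ c → ∀ y : Tensor ℂ m,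
      evalT (fun x y' z =>
        if ((x = a ∨ x = a') ∧ (y' = b ∨ y' = b') ∧ (z = c ∨ z = c')) ∨
            (x ≠ a ∧ x ≠ a' ∧ y' ≠ b ∧ y' ≠ b' ∧ z ≠ c ∧ z ≠ c')
        then y x y' z else 0) f = 0)
    {r : ℕ} (hr : (k - 1) * (r - 1) < k * (m - 1)) {t : Tensor ℂ m} (ht : tensorRank t ≤ r) : evalT t f = 0 := by
  classical
  have hΛ : ∀ (s : Fin 3) (i : Fin m), rectType m m k s i = k := fun s i => rectType_self_apply k s i
  have hEC := fun {μ : Idx m →₀ ℕ} (hμ : μ ∈ f.support) (p : Idx m) =>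
    exponent_at_cell hf (hΛ 0 p.1) (hΛ 1 p.2.1) (hΛ 2 p.2.2) hμ
  -- the top coefficient `g = f^{(e)}` at `e = (a,b,c)`
  obtain ⟨g, hghom, hgsupp, hgtop⟩ := exists_topCoeff hf (hΛ 0 a) (hΛ 1 b) (hΛ 2 c)
  -- (1) every exponent of `g` is `≤ k - 1`
  have hgexp : ∀ ν ∈ g.support, ∀ p : Idx m, ν p ≤ k - 1 := by
    intro ν hν p
    obtain ⟨hνe, μ, hμ, hμe, hνμ⟩ := hgsupp ν hν
    by_cases hpe : p = (a, b, c)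
    · rw [hpe, hνe]
      exact Nat.zero_le _
    rw [hνμ p hpe]
    have hle : μ p ≤ k := by
      have h := (hEC hμ p).1
      simpa only [Prod.mk.eta] using h
    rcases Nat.lt_or_ge (μ p) k with hlt | hge
    · omega
    have hpk : μ p = k := le_antisymm hle hge
    rcases Nat.eq_zero_or_pos k with hk0 | hk0
    · omega
    exfalso
    have hps : p ∈ μ.support := Finsupp.mem_support_iff.mpr (by omega)
    -- `p` avoids the three slices through `e`
    obtain ⟨h1, h2, h3⟩ := (hEC hμ (a, b, c)).2.1 hμe p hps hpe
    -- hence the block window `{a,p₁}×{b,p₂}×{c,p₃}` applies and kills the coefficient of `x^μ`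
    refine MvPolynomial.mem_support_iff.mp hμ (coeff_eq_zero_of_evalT_kill f
      (fun x y' z => ((x = a ∨ x = p.1) ∧ (y' = b ∨ y' = p.2.1) ∧ (z = c ∨ z = p.2.2)) ∨
        (x ≠ a ∧ x ≠ p.1 ∧ y' ≠ b ∧ y' ≠ p.2.1 ∧ z ≠ c ∧ z ≠ p.2.2))
      (hblock p.1 p.2.1 p.2.2 h1 h2 h3) fun q hq => ?_)
    by_cases hqe : q = (a, b, c)
    · rw [hqe]
      exact Or.inl ⟨Or.inl rfl, Or.inl rfl, Or.inl rfl⟩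
    by_cases hqp : q = p
    · rw [hqp]
      exact Or.inl ⟨Or.inr rfl, Or.inr rfl, Or.inr rfl⟩
    obtain ⟨hq1, hq2, hq3⟩ := (hEC hμ (a, b, c)).2.1 hμe q hq hqe
    have hp' := (hEC hμ p).2.1
    simp only [Prod.mk.eta] at hp'
    obtain ⟨hq1', hq2', hq3'⟩ := hp' hpk q hq hqp
    exact Or.inr ⟨hq1, hq1', hq2, hq2', hq3, hq3'⟩
  -- (2) line degree of `g` along every coordinate cell, then along every triad
  have hgline : ∀ (a' b' c' : Fin m) (y : Tensor ℂ m), ∃ Q : Polynomial ℂ, Q.natDegree ≤ k - 1 ∧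
      ∀ v : ℂ, evalT (y + v • triad (Pi.single a' 1) (Pi.single b' 1) (Pi.single c' 1)) g = Q.eval v :=
    fun a' b' c' y => lineDegree_of_exponent_le (fun ν hν => hgexp ν hν (a', b', c')) y
  have hgtriad := lineDegree_topCoeff_triad hf hgtop hgline
  -- (3) the secant polynomial has degree `≤ k - 1` in every variable
  obtain ⟨x₁, x₂, x₃, rfl⟩ := exists_eq_sum_triad_of_tensorRank_le ht
  set T : Fin r → Tensor ℂ m := fun i => triad (x₁ i) (x₂ i) (x₃ i) with hT
  have hΦ : MvPolynomial.aeval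
      (fun p : Idx m => ∑ i : Fin r, MvPolynomial.C (T i p.1 p.2.1 p.2.2) * MvPolynomial.X i) f = 0 := by
    refine eq_zero_of_isHomogeneous_of_degreeOf_le (secant_isHomogeneous T hf.1)
      (fun j => degreeOf_le_of_lineDegree j fun cc => ?_)
      (by simpa only [Fintype.card_fin] using pairLaw_arith hr)
    obtain ⟨n, hn⟩ : ∃ n, r = n + 1 := ⟨r - 1, (Nat.succ_pred_eq_of_pos j.pos).symm⟩
    subst hn
    -- base point: the other `n` summands
    set zb : Tensor ℂ m := ∑ l : Fin n, cc (j.succAbove l) • T (j.succAbove l) with hzb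
    have hsplit : ∀ u : ℂ, (∑ i, Function.update cc j u i • T i) = u • T j + zb := by
      intro u
      rw [Fin.sum_univ_succAbove _ j, Function.update_self]
      congr 1
      refine Finset.sum_congr rfl fun l _ => ?_
      rw [Function.update_of_ne (Fin.succAbove_ne j l)]
    by_cases h0 : x₁ j = 0 ∨ x₂ j = 0 ∨ x₃ j = 0
    · refine ⟨Polynomial.C (evalT zb f), (Polynomial.natDegree_C _).le.trans (Nat.zero_le _), fun u => ?_⟩
      rw [eval_secant, hsplit, hT]
      simp only
      rw [triad_eq_zero_of_factor h0, smul_zero, zero_add, Polynomial.eval_C]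
    have h0' : x₁ j ≠ 0 ∧ x₂ j ≠ 0 ∧ x₃ j ≠ 0 :=
      ⟨fun h => h0 (Or.inl h), fun h => h0 (Or.inr (Or.inl h)), fun h => h0 (Or.inr (Or.inr h))⟩
    obtain ⟨A, B, C, hA, hB, hC, hABC⟩ := exists_actTensor_coord_eq_triad h0'.1 h0'.2.1 h0'.2.2 a b c
    obtain ⟨χ, -, hχ⟩ := exists_evalT_actTensor_eq_mul hf (fun s i j => rectType_self_const k s i j) hA hB hC
    have hzb' : zb = actTensor A B C (actTensor A⁻¹ B⁻¹ C⁻¹ zb) := by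
      rw [actTensor_actTensor, Matrix.mul_nonsing_inv A (isUnit_iff_ne_zero.mpr hA),
        Matrix.mul_nonsing_inv B (isUnit_iff_ne_zero.mpr hB), Matrix.mul_nonsing_inv C (isUnit_iff_ne_zero.mpr hC),
        actTensor_one]
    -- `g` vanishes at `h⁻¹ zb`, a sum of `n` triads, by part H applied to `g`
    have hg0 : evalT (actTensor A⁻¹ B⁻¹ C⁻¹ zb) g = 0 := by
      rw [hzb, actTensor_finset_sum]
      have hdir : ∀ l : Fin n, actTensor A⁻¹ B⁻¹ C⁻¹ (cc (j.succAbove l) • T (j.succAbove l)) =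
          triad (A⁻¹.mulVec (cc (j.succAbove l) • x₁ (j.succAbove l))) (B⁻¹.mulVec (x₂ (j.succAbove l)))
            (C⁻¹.mulVec (x₃ (j.succAbove l))) := by
        intro l
        rw [hT]
        simp only
        rw [smul_triad, actTensor_triad]
      simp only [hdir]
      refine evalT_sum_eq_zero_of_lineDegree hghom _ (fun w l => hgtriad _ _ _ w) ?_
      have h1 : k * (m - 1) = k * m - k := Nat.mul_sub_one k m
      have h2 : (k - 1) * n < k * (m - 1) := by simpa only [Nat.add_sub_cancel] using hr
      omega
    obtain ⟨Q₀, hQ₀deg, hQ₀top, hQ₀⟩ := hgtop (actTensor A⁻¹ B⁻¹ C⁻¹ zb)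
    rw [hg0] at hQ₀top
    have hQ₀deg' : Q₀.natDegree ≤ k - 1 := by
      by_contra hlt
      have hk : Q₀.natDegree = k := le_antisymm hQ₀deg (by omega)
      have hlc : Q₀.leadingCoeff = 0 := by rw [Polynomial.leadingCoeff, hk, hQ₀top]
      rw [Polynomial.leadingCoeff_eq_zero] at hlc
      rw [hlc, Polynomial.natDegree_zero] at hk
      omega
    refine ⟨Polynomial.C χ * Q₀, (Polynomial.natDegree_C_mul_le _ _).trans hQ₀deg', fun u => ?_⟩
    rw [eval_secant, hsplit, Polynomial.eval_mul, Polynomial.eval_C, ← hQ₀ u, ← hχ, actTensor_add',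
      actTensor_smul', ← hzb', hABC, add_comm]
  have h := eval_secant T f fun _ => 1
  rw [hΦ, map_zero] at h
  simpa only [one_smul] using h.symm

/-- **The pair law at level 3** (H19 as read on the bus): a full-format (`m ≥ 2`) level-`3` vector with dead block
windows through a cell vanishes on every tensor of rank `≤ r` whenever `2r + 1 < 3m` — so `r_m(3) ≥ ⌈(3m − 1)/2⌉`:
`r₄(3) ≥ 6`, `r₆(3) ≥ 9`, `r₈(3) ≥ 12`, `r₉(3) ≥ 13`. [this node] -/
theorem evalT_eq_zero_of_blockWindow_level_three {f : MvPolynomial (Idx m) ℂ}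
    (hf : f ∈ hwvSpace (rectType m m 3) (3 * m)) {a b c : Fin m}
    (hblock : ∀ a' b' c' : Fin m, a' ≠ a → b' ≠ b → c' ≠ c → ∀ y : Tensor ℂ m,
      evalT (fun x y' z =>
        if ((x = a ∨ x = a') ∧ (y' = b ∨ y' = b') ∧ (z = c ∨ z = c')) ∨
            (x ≠ a ∧ x ≠ a' ∧ y' ≠ b ∧ y' ≠ b' ∧ z ≠ c ∧ z ≠ c')
        then y x y' z else 0) f = 0)
    (hm : 2 ≤ m) {r : ℕ} (hr : 2 * r + 1 < 3 * m) {t : Tensor ℂ m} (ht : tensorRank t ≤ r) :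
    evalT t f = 0 := by
  have hr' : (3 - 1) * (r - 1) < 3 * (m - 1) := by
    show 2 * (r - 1) < 3 * (m - 1)
    omega
  exact evalT_eq_zero_of_blockWindow hf hblock hr' ht

end PairLaw

/-! ### §5 Dead block windows from the empty level at block format 2 (the Kronecker input, tower language) -/

section EmptyLevelTwo

/-- Two prescribed values for a permutation: some `σ` has `σ i₁ = p` and `σ i₂ = q` (`i₁ ≠ i₂`, `p ≠ q`). [bookkeeping] -/
theorem exists_perm_apply_eq_pair {i₁ i₂ p q : Fin m} (hi : i₁ ≠ i₂) (hpq : p ≠ q) :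
    ∃ σ : Equiv.Perm (Fin m), σ i₁ = p ∧ σ i₂ = q := by
  classical
  set τ : Equiv.Perm (Fin m) := Equiv.swap i₁ p with hτ
  have hτ₁ : τ i₁ = p := Equiv.swap_apply_left i₁ p
  have hj : τ q ≠ i₁ := by
    intro h
    have h' := congrArg τ h
    rw [hτ, Equiv.swap_apply_self, ← hτ, hτ₁] at h'
    exact hpq h'.symm
  refine ⟨τ * Equiv.swap i₂ (τ q), ?_, ?_⟩
  · rw [Equiv.Perm.mul_apply, Equiv.swap_apply_of_ne_of_ne hi hj.symm, hτ₁]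
  · rw [Equiv.Perm.mul_apply, Equiv.swap_apply_left, hτ, Equiv.swap_apply_self]

/-- **Dead block windows from an empty level (H13 + H12).**  If level `k` is EMPTY at block format `2`
(`k ∈ emptyLevels m 2`: no weight vector of type `((k,k))³` in degree `2k` on the last `2×2×2` block — for `k = 3` the
Kronecker vacuity `g((3,3),(3,3),(3,3)) = 0`), then every full-format level-`k` vector vanishes at every tensor supported
on a block window `{a,a'}×{b,b'}×{c,c'} ∪ (complementary corner)`: three slot relabellings (Levi–Weyl law H12,
`pointLevels_slotAct_permMatrix`) move the window to the last two indices, where the Levi restriction law H13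
(`not_mem_pointLevels_of_emptyLevel_last`) applies. [this node] -/
theorem blockWindow_dead_of_emptyLevel_two {k : ℕ} (hk : k ∈ emptyLevels m 2) {f : MvPolynomial (Idx m) ℂ}
    (hf : f ∈ hwvSpace (rectType m m k) (k * m)) {a a' b b' c c' : Fin m} (ha : a' ≠ a) (hb : b' ≠ b)
    (hc : c' ≠ c) (y : Tensor ℂ m) :
    evalT (fun x y' z =>
      if ((x = a ∨ x = a') ∧ (y' = b ∨ y' = b') ∧ (z = c ∨ z = c')) ∨
          (x ≠ a ∧ x ≠ a' ∧ y' ≠ b ∧ y' ≠ b' ∧ z ≠ c ∧ z ≠ c')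
      then y x y' z else 0) f = 0 := by
  classical
  have hav : (a : ℕ) ≠ a' := fun h => ha (Fin.ext h).symm
  have h2 : 2 ≤ m := by have := a.isLt; have := a'.isLt; omega
  set i₁ : Fin m := ⟨m - 2, by omega⟩ with hi₁
  set i₂ : Fin m := ⟨m - 1, by omega⟩ with hi₂
  have hi : i₁ ≠ i₂ := fun h => by
    have h' := congrArg Fin.val h
    rw [hi₁, hi₂] at h'
    simp only at h'
    omega
  have hlast : ∀ i : Fin m, m ≤ (i : ℕ) + 2 ↔ i = i₁ ∨ i = i₂ := by
    intro i
    constructor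
    · intro h
      have := i.isLt
      by_cases h1 : (i : ℕ) = m - 2
      · exact Or.inl (Fin.ext (by rw [hi₁]; exact h1))
      · exact Or.inr (Fin.ext (by rw [hi₂]; simp only; omega))
    · rintro (rfl | rfl)
      · show m ≤ (m - 2) + 2
        omega
      · show m ≤ (m - 1) + 2
        omega
  -- slot relabellings with `σ₀ i₁ = a, σ₀ i₂ = a'` etc.
  obtain ⟨σ₀, hσ₀₁, hσ₀₂⟩ := exists_perm_apply_eq_pair hi ha.symm
  obtain ⟨σ₁, hσ₁₁, hσ₁₂⟩ := exists_perm_apply_eq_pair hi hb.symm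
  obtain ⟨σ₂, hσ₂₁, hσ₂₂⟩ := exists_perm_apply_eq_pair hi hc.symm
  have hwin : ∀ (σ : Equiv.Perm (Fin m)) (p q : Fin m), σ i₁ = p → σ i₂ = q → ∀ i : Fin m,
      (σ i = p ∨ σ i = q) ↔ m ≤ (i : ℕ) + 2 := by
    intro σ p q hp hq i
    rw [hlast]
    constructor
    · rintro (h | h)
      · exact Or.inl (σ.injective (h.trans hp.symm))
      · exact Or.inr (σ.injective (h.trans hq.symm))
    · rintro (rfl | rfl)
      · exact Or.inl hp
      · exact Or.inr hq
  set y' : Tensor ℂ m := fun x y' z =>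
    if ((x = a ∨ x = a') ∧ (y' = b ∨ y' = b') ∧ (z = c ∨ z = c')) ∨
        (x ≠ a ∧ x ≠ a' ∧ y' ≠ b ∧ y' ≠ b' ∧ z ≠ c ∧ z ≠ c')
    then y x y' z else 0 with hy'
  set x : Tensor ℂ m := actTensor (σ₀.permMatrix ℂ) (σ₁.permMatrix ℂ) (σ₂.permMatrix ℂ) y' with hx
  -- the relabelled tensor is block-diagonal for the last two indices
  have hxB : x ∈ blockDiag m 2 := by
    refine mem_blockDiag.2 fun i j l hne => ?_
    rw [hx, actTensor_permMatrix_apply, hy'] at hne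
    simp only [ne_eq, ite_eq_right_iff, Classical.not_imp] at hne
    obtain ⟨hcond, -⟩ := hne
    rw [← hwin σ₀ a a' hσ₀₁ hσ₀₂ i, ← hwin σ₁ b b' hσ₁₁ hσ₁₂ j, ← hwin σ₂ c c' hσ₂₁ hσ₂₂ l]
    rcases hcond with ⟨h₁, h₂, h₃⟩ | ⟨h₁, h₁', h₂, h₂', h₃, h₃'⟩
    · exact Or.inl ⟨h₁, h₂, h₃⟩
    · exact Or.inr ⟨not_or.mpr ⟨h₁, h₁'⟩, not_or.mpr ⟨h₂, h₂'⟩, not_or.mpr ⟨h₃, h₃'⟩⟩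
  -- levels are invariant under the three relabellings (H12), and the last block of size 2 carries no level `k` (H13)
  have hlev : pointLevels m x = pointLevels m y' := by
    have h3 : x = slotAct 0 (σ₀.permMatrix ℂ) (slotAct 1 (σ₁.permMatrix ℂ) (slotAct 2 (σ₂.permMatrix ℂ) y')) := by
      rw [hx]
      simp only [slotAct_zero, slotAct_one, slotAct_two, actTensor_actTensor, Matrix.mul_one, Matrix.one_mul]
    have hσ : ∀ (σ : Equiv.Perm (Fin m)) (e : Fin m), σ e ≠ e → m ≤ (e : ℕ) + m := fun σ e _ => Nat.le_add_left m e
    rw [h3, pointLevels_slotAct_permMatrix m 0 σ₀ (hσ σ₀), pointLevels_slotAct_permMatrix m 1 σ₁ (hσ σ₁),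
      pointLevels_slotAct_permMatrix m 2 σ₂ (hσ σ₂)]
  have hnot : k ∉ pointLevels m y' := by
    rw [← hlev]
    exact not_mem_pointLevels_of_emptyLevel_last h2 h2 hxB hk
  by_contra hne
  exact hnot ⟨f, hf, hne⟩

/-- **THE PAIR LAW, tower form.**  If level `k` is empty at block format `2` then every full-format level-`k` vector
vanishes at every tensor of rank `≤ r` with `(k−1)(r−1) < k(m−1)`: `k ∉ E'_m(t)`.  The only input is the emptiness
`k ∈ emptyLevels m 2` — for `k = 3` the Kronecker vacuity `k₂(3) = 0` of the census. [this node] -/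
theorem evalT_eq_zero_of_emptyLevel_two {k : ℕ} (hk : k ∈ emptyLevels m 2) {f : MvPolynomial (Idx m) ℂ}
    (hf : f ∈ hwvSpace (rectType m m k) (k * m)) {r : ℕ} (hr : (k - 1) * (r - 1) < k * (m - 1))
    {t : Tensor ℂ m} (ht : tensorRank t ≤ r) : evalT t f = 0 := by
  have hm : 1 ≤ m := by
    rcases Nat.eq_zero_or_pos m with h | h
    · rw [h] at hr
      simp at hr
    · exact h
  exact evalT_eq_zero_of_blockWindow hf (a := ⟨0, hm⟩) (b := ⟨0, hm⟩) (c := ⟨0, hm⟩)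
    (fun a' b' c' ha hb hc y => blockWindow_dead_of_emptyLevel_two hk hf ha hb hc y) hr ht

/-- The same in level language: an empty level at block format `2` is not a level of any tensor of rank `≤ r`,
`(k−1)(r−1) < k(m−1)`. [this node] -/
theorem not_mem_pointLevels_of_emptyLevel_two {k : ℕ} (hk : k ∈ emptyLevels m 2) {r : ℕ}
    (hr : (k - 1) * (r - 1) < k * (m - 1)) {t : Tensor ℂ m} (ht : tensorRank t ≤ r) : k ∉ pointLevels m t := by
  rintro ⟨f, hf, hne⟩
  exact hne (evalT_eq_zero_of_emptyLevel_two hk hf hr ht)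

/-- **H19 at level 3, tower form.**  If `3 ∈ emptyLevels m 2` (`g((3,3),(3,3),(3,3)) = 0`) and `m ≥ 2`, every
full-format level-`3` vector vanishes on all tensors of rank `≤ r` with `2r + 1 < 3m`: `r_m(3) ≥ ⌈(3m−1)/2⌉` —
`r₄(3) ≥ 6`, `r₆(3) ≥ 9` (exact, census `c₅₁ = 36/5`), `r₈(3) ≥ 12`, `r₉(3) ≥ 13`. [this node]
[cite: BurgisserIkenmeyer2011, §6.2] -/
theorem evalT_eq_zero_of_emptyLevel_two_level_three (hk : 3 ∈ emptyLevels m 2) {f : MvPolynomial (Idx m) ℂ}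
    (hf : f ∈ hwvSpace (rectType m m 3) (3 * m)) (hm : 2 ≤ m) {r : ℕ} (hr : 2 * r + 1 < 3 * m)
    {t : Tensor ℂ m} (ht : tensorRank t ≤ r) : evalT t f = 0 := by
  have hr' : (3 - 1) * (r - 1) < 3 * (m - 1) := by
    show 2 * (r - 1) < 3 * (m - 1)
    omega
  exact evalT_eq_zero_of_emptyLevel_two hk hf hr' ht

end EmptyLevelTwo

end Summit.MatrixMultiplication.MatrixMultiplication.Theorems.ObstructionCalculus
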